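/-
Copyright (c) 2026 the pub-hodgecm-mathlib formalisation cell (harness21).  Prover seat hodgecm-mathlib-K2-defs1 (g6), Track B, h413 = `stmt-HodgeConjecture-24833`, route `HCCMUnconditional`,
deal (259) of dealer K2E1-plan (g7) 2026-09-04T13:43:37Z (the dischargeable half, per my 13:44Z report): the GENERAL-LEVEL (χ,τ) ball data with the letters `hfam`∕`hnc` GONE.
-/
import Summits.HodgeConjecture.HodgeConjecture.Theorems.K2E1ChiConvDataCMTwo            -- ★ p859925 (K2E1-p14): `exists_chi_convData_cm_two` (hypothesis-first on `V`, `hfam`, `hnc`)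
import Summits.HodgeConjecture.HodgeConjecture.Theorems.K2E1ArchSymbolCirclePhaseU2     -- ★ p860525 (this seat): `hfam_gauge_cm_two`, `hnc_gauge_cm_two` (every `(χ_∞, ω)`)
import Summits.HodgeConjecture.HodgeConjecture.Theorems.K2E1ChiSymbolWeylSymmetrySelfDualCMTwo   -- ★ (K2E2-p12): `chi_symbol_hsymm_of_selfDual_cm_two` (ED. 2)
import Summits.HodgeConjecture.HodgeConjecture.Theorems.K2E1AnalyticLevelSetNullU               -- ★ (K2E4-p23): `frequently_line_nhdsWithin` (ED. 2)
import HarnessLib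

/-!
# (259) — `K2E1ChiConvDataLevelCMTwo`: THE (χ,τ) BALL DATA AT A GENERAL LEVEL — ★ convData_χ `exists_chi_convData_cm_two` AT `V := chiSectionSpace χ K′ ω` WITH ITS LETTERS `hfam`∕`hnc`
# DISCHARGED by the archimedean gauge family (★ `K2E1ArchSymbolCirclePhaseU2`): per ball, test functions `η_i`, levels `κ_i`, operators `T_i`, ENTIRE eigenvalues `ŝ_i` acting by
# `∫ S_η̃η̃·f_z^φ(x·) = ŝ_i(z)·f_z^φ(x)` on every `φ ∈ V`, an `ŝ`-cover of the ball, and one NON-CONSTANT `ŝ_{i₀}`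

Cell `pub/hodgecm-mathlib`, crux H413 = `stmt-HodgeConjecture-24833`.  THEOREMS ONLY (no `def`, no `instance`, no notation, no named-fact hypothesis, no `sorry`); lane `--supports
stmt-HodgeConjecture-24833 --as helper` (count-neutral).  Closes no socket.  CM pair `L∕L⁺`, `N = 2`; general level `K′` (the general-(U,τ) twin of ★ `exists_convData_maximalLevel_cm_two`).

THE MATHEMATICS ([BernsteinLapid2019, §4 Claim 1]; [Bump1997, proof of Lemma 2.3.2]).  One call of ★ `exists_chi_convData_cm_two` with `V := chiSectionSpace χ K′ ω` and the letters supplied by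
★ `hfam_gauge_cm_two` ∕ ★ `hnc_gauge_cm_two`.  This is the `hCD`-bundle of the GENERIC-EIGENVALUE exports chain (★ X1_χ-eigen p860174, ★ core-eigen p860182); the spherical-transform-wired
`hCD` of ★ `chiEisenstein_meromorphic_exports_cm_two_of_letters` is an M1-only currency (K2E1-p14 R4) and is NOT claimed here.
* HEAD **`exists_chi_convData_level_cm_two`** — structural binders: `K′ ≤ K`, `ι(K_∞) ⊆ K′`, `U₀ ≤ GL₂(𝔸_L^∞)` open compact with `ι_f(U₀ ∩ G_f) ⊆ K′` and `ω = 1` there, continuity of the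
  sections, and auxiliary Haar measures `μ_∞` (two-sided) on `G_∞`, `μ_f` on `G(𝔸_f)` (proof-only).
HONEST LABEL: HC_CM is proved only modulo the 7 printed citations (2 remaining named inputs: hLiu418 = `stmt-HodgeConjecture-24832`, h413 = `stmt-HodgeConjecture-24833`) until rung 0
closes; count-neutral helper, closes no socket.

## References
* [BernsteinLapid2019] J. Bernstein, E. Lapid, *On the meromorphic continuation of Eisenstein series*, J. AMS 37 (2024), §4 Claim 1.  * [Bump1997] D. Bump, *Automorphic Forms and
  Representations* (1997), proof of Lemma 2.3.2.
-/

set_option autoImplicit false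
set_option linter.dupNamespace false  -- the mandated namespace repeats the summit's segment (`HodgeConjecture.HodgeConjecture`)

noncomputable section

open MeasureTheory Measure Filter Topology Set NumberField IsDedekindDomain
open scoped NNReal ENNReal ComplexConjugate MatrixGroups
open Literature.MeasureTheory.Group Literature.NumberTheory Literature.NumberTheory.Automorphic Literature.NumberTheory.Automorphic.UnitaryGroup AdelicGroupData
open Literature.NumberTheory.GaloisRepresentations (HeckeCharacter)
open Summit.HodgeConjecture.HodgeConjecture.Cruxes.H413.K2E1BorelEisensteinU
open Summit.HodgeConjecture.HodgeConjecture.Cruxes.H413.K2E1BLBorelSpacesU2Defs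
open Summit.HodgeConjecture.HodgeConjecture.Cruxes.H413.K2E1BLBorelOperatorsU2Defs
open Summit.HodgeConjecture.HodgeConjecture.Cruxes.H413.K2E1BLIotaClosedEmbeddingU2 (iotaBound_cm)
open Summit.HodgeConjecture.HodgeConjecture.Cruxes.H413.K2E1CharacterEisensteinU2Defs
open Summit.HodgeConjecture.HodgeConjecture.Cruxes.H413.K2E1ChiSectionSpaceU2Defs
open Summit.HodgeConjecture.HodgeConjecture.Cruxes.H413.K2E1ChiConvDataCMTwo (exists_chi_convData_cm_two)
open Summit.HodgeConjecture.HodgeConjecture.Cruxes.H413.K2E1ArchSymbolCirclePhaseU2 (hfam_gauge_cm_two hnc_gauge_cm_two)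
open Summit.HodgeConjecture.HodgeConjecture.Cruxes.H413.K2E1ChiSymbolWeylSymmetrySelfDualCMTwo (chi_symbol_hsymm_of_selfDual_cm_two)
open Summit.HodgeConjecture.HodgeConjecture.Cruxes.H413.K2E1AnalyticLevelSetNullU (frequently_line_nhdsWithin)

namespace Summit.HodgeConjecture.HodgeConjecture.Cruxes.H413.K2E1ChiConvDataLevelCMTwo

variable (L : Type) [Field L] [NumberField L] [IsCMField L]
  [MeasurableSpace (quasiSplit (↥(maximalRealSubfield L)) L (IsCMField.complexConj L) 2).Adelic] [BorelSpace (quasiSplit (↥(maximalRealSubfield L)) L (IsCMField.complexConj L) 2).Adelic]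
  [MeasurableSpace (arch (↥(maximalRealSubfield L)) L (IsCMField.complexConj L) 2 ((StdForm.antidiagonal 2).over L))] [BorelSpace (arch (↥(maximalRealSubfield L)) L (IsCMField.complexConj L) 2 ((StdForm.antidiagonal 2).over L))]
  [MeasurableSpace (finAdelic (↥(maximalRealSubfield L)) L (IsCMField.complexConj L) 2 ((StdForm.antidiagonal 2).over L))] [BorelSpace (finAdelic (↥(maximalRealSubfield L)) L (IsCMField.complexConj L) 2 ((StdForm.antidiagonal 2).over L))]

/-- **THE (χ,τ) BALL DATA AT A GENERAL LEVEL, LETTERS GONE** (general-(U,τ) twin of ★ `exists_convData_maximalLevel_cm_two`): ★ `exists_chi_convData_cm_two` at `V := chiSectionSpace χ K′ ω`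
with `hfam := hfam_gauge_cm_two`, `hnc := hnc_gauge_cm_two`.  Conclusion VERBATIM ★ convData_χ's (with `V` instantiated). [cite: BernsteinLapid2019, §4 Claim 1] [cite: Bump1997, proof of Lemma 2.3.2] -/
theorem exists_chi_convData_level_cm_two
    (μ : Measure (quasiSplit (↥(maximalRealSubfield L)) L (IsCMField.complexConj L) 2).automorphicQuotient)
    [(quasiSplit (↥(maximalRealSubfield L)) L (IsCMField.complexConj L) 2).IsAutomorphicMeasure μ]
    (νG : Measure (quasiSplit (↥(maximalRealSubfield L)) L (IsCMField.complexConj L) 2).Adelic) [νG.IsHaarMeasure] [νG.IsInvInvariant] [SFinite νG]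
    {β : (quasiSplit (↥(maximalRealSubfield L)) L (IsCMField.complexConj L) 2).Adelic → ℝ≥0∞}
    (hβ : IsCoveringWeight ↥((arithmeticBorel (↥(maximalRealSubfield L)) L (IsCMField.complexConj L) 2).map
      (quasiSplit (↥(maximalRealSubfield L)) L (IsCMField.complexConj L) 2).arithmeticSubgroup.subtype) β)
    {μZ : Measure (borelQuotient (↥(maximalRealSubfield L)) L (IsCMField.complexConj L) 2)} [SFinite μZ]
    (hμZ : ∀ f : borelQuotient (↥(maximalRealSubfield L)) L (IsCMField.complexConj L) 2 → ℝ≥0∞, Measurable f →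
      ∫⁻ z, f z ∂μZ = ∫⁻ g, β g * f (toBorelQuotient (↥(maximalRealSubfield L)) L (IsCMField.complexConj L) 2 g) ∂νG)
    -- auxiliary Haar measures on `G_∞` (two-sided) and `G(𝔸_f)` (they only enter the proof of the letters)
    (μa : Measure (arch (↥(maximalRealSubfield L)) L (IsCMField.complexConj L) 2 ((StdForm.antidiagonal 2).over L))) [μa.IsHaarMeasure] [μa.IsMulRightInvariant]
    (μf : Measure (finAdelic (↥(maximalRealSubfield L)) L (IsCMField.complexConj L) 2 ((StdForm.antidiagonal 2).over L))) [μf.IsHaarMeasure]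
    -- the section space `V(χ, K′, ω)` and its structural binders
    {χ : HeckeCharacter L} {K' : Subgroup (quasiSplit (↥(maximalRealSubfield L)) L (IsCMField.complexConj L) 2).Adelic} {ω : ↥K' → ℂ}
    (hK' : K' ≤ ((standardMaximalCompactGL 2 L).comap (adelicVal (↥(maximalRealSubfield L)) L (IsCMField.complexConj L) 2 ((StdForm.antidiagonal 2).over L)) : Subgroup (quasiSplit (↥(maximalRealSubfield L)) L (IsCMField.complexConj L) 2).Adelic))
    (hKinf : ∀ k : arch (↥(maximalRealSubfield L)) L (IsCMField.complexConj L) 2 ((StdForm.antidiagonal 2).over L), adelicVal (↥(maximalRealSubfield L)) L (IsCMField.complexConj L) 2 ((StdForm.antidiagonal 2).over L) (archToAdelic (↥(maximalRealSubfield L)) L (IsCMField.complexConj L) 2 _ k) ∈ standardMaximalCompactGL 2 L →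
      archToAdelic (↥(maximalRealSubfield L)) L (IsCMField.complexConj L) 2 _ k ∈ K')
    (U₀ : Subgroup (GL (Fin 2) (FiniteAdeleRing (𝓞 L) L))) (hU₀o : IsOpen (U₀ : Set (GL (Fin 2) (FiniteAdeleRing (𝓞 L) L)))) (hU₀c : IsCompact (U₀ : Set (GL (Fin 2) (FiniteAdeleRing (𝓞 L) L))))
    (hU : ∀ b : finAdelic (↥(maximalRealSubfield L)) L (IsCMField.complexConj L) 2 ((StdForm.antidiagonal 2).over L), (b : GL (Fin 2) (FiniteAdeleRing (𝓞 L) L)) ∈ U₀ →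
      ∃ hb : finAdelicToAdelic (↥(maximalRealSubfield L)) L (IsCMField.complexConj L) 2 ((StdForm.antidiagonal 2).over L) b ∈ K', ω ⟨_, hb⟩ = 1)
    (hVc : ∀ φ ∈ chiSectionSpace χ K' ω, Continuous φ)
    (n : ℕ) :
    ∃ (a : ℝ≥0) (ha : 0 < a) (I : Type) (_ : Fintype I) (i₀ : I) (η : I → GL (Fin 2) (AdeleRing (𝓞 L) L) → ℝ) (κ : I → ℝ≥0)
      (T : I → HX (↥(maximalRealSubfield L)) L (IsCMField.complexConj L) 2 (n + 3) μ →L[ℂ] HX (↥(maximalRealSubfield L)) L (IsCMField.complexConj L) 2 (n + 3) μ) (ŝ : I → ℂ → ℂ),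
      -- the test functions `η_i` (smooth, non-negative, symmetric) and the self-convolutions `h_i = S_{η_i} η_i` (continuous, compactly supported, symmetric, real, `Re ≥ 0`)
      (∀ i, IsTestFunctionGL 2 L (η i) ∧ (∀ g, 0 ≤ η i g) ∧ (∀ g, η i g⁻¹ = η i g)) ∧
      (∀ i, Continuous (fun y : (quasiSplit (↥(maximalRealSubfield L)) L (IsCMField.complexConj L) 2).Adelic => orbitalSmoothing νG (fun x : (quasiSplit (↥(maximalRealSubfield L)) L (IsCMField.complexConj L) 2).Adelic => ((η i (adelicVal (↥(maximalRealSubfield L)) L (IsCMField.complexConj L) 2 ((StdForm.antidiagonal 2).over L) x) : ℝ) : ℂ)) (fun x : (quasiSplit (↥(maximalRealSubfield L)) L (IsCMField.complexConj L) 2).Adelic => ((η i (adelicVal (↥(maximalRealSubfield L)) L (IsCMField.complexConj L) 2 ((StdForm.antidiagonal 2).over L) x) : ℝ) : ℂ)) y) ∧ HasCompactSupport (fun y : (quasiSplit (↥(maximalRealSubfield L)) L (IsCMField.complexConj L) 2).Adelic => orbitalSmoothing νG (fun x : (quasiSplit (↥(maximalRealSubfield L)) L (IsCMField.complexConj L)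 2).Adelic => ((η i (adelicVal (↥(maximalRealSubfield L)) L (IsCMField.complexConj L) 2 ((StdForm.antidiagonal 2).over L) x) : ℝ) : ℂ)) (fun x : (quasiSplit (↥(maximalRealSubfield L)) L (IsCMField.complexConj L) 2).Adelic => ((η i (adelicVal (↥(maximalRealSubfield L)) L (IsCMField.complexConj L) 2 ((StdForm.antidiagonal 2).over L) x) : ℝ) : ℂ)) y) ∧
        (∀ g, (fun y : (quasiSplit (↥(maximalRealSubfield L)) L (IsCMField.complexConj L) 2).Adelic => orbitalSmoothing νG (fun x : (quasiSplit (↥(maximalRealSubfield L)) L (IsCMField.complexConj L) 2).Adelic => ((η i (adelicVal (↥(maximalRealSubfield L)) L (IsCMField.complexConj L) 2 ((StdForm.antidiagonal 2).over L) x) : ℝ) : ℂ)) (fun x : (quasiSplit (↥(maximalRealSubfield L)) L (IsCMField.complexConj L) 2).Adelic => ((η i (adelicVal (↥(maximalRealSubfield L)) L (IsCMField.complexConj L) 2 ((StdForm.antidiagonal 2).over L) x) : ℝ) : ℂ)) y) g⁻¹ = (fun y : (quasiSplit (↥(maximalRealSubfield L)) L (IsCMField.complexConj L) 2).Adelic =>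 orbitalSmoothing νG (fun x : (quasiSplit (↥(maximalRealSubfield L)) L (IsCMField.complexConj L) 2).Adelic => ((η i (adelicVal (↥(maximalRealSubfield L)) L (IsCMField.complexConj L) 2 ((StdForm.antidiagonal 2).over L) x) : ℝ) : ℂ)) (fun x : (quasiSplit (↥(maximalRealSubfield L)) L (IsCMField.complexConj L) 2).Adelic => ((η i (adelicVal (↥(maximalRealSubfield L)) L (IsCMField.complexConj L) 2 ((StdForm.antidiagonal 2).over L) x) : ℝ) : ℂ)) y) g) ∧ (∀ g, conj ((fun y : (quasiSplit (↥(maximalRealSubfield L)) L (IsCMField.complexConj L) 2).Adelic => orbitalSmoothing νG (fun x : (quasiSplit (↥(maximalRealSubfield L)) L (IsCMField.complexConj L) 2).Adelic => ((η i (adelicVal (↥(maximalRealSubfield L)) L (IsCMField.complexConj L) 2 ((StdForm.antidiagonal 2).over L) x) : ℝ) : ℂ)) (fun x : (quasiSplit (↥(maximalRealSubfield L)) L (IsCMField.complexConj L) 2).Adelic => ((η i (adelicVal (↥(maximalRealSubfield L)) L (IsCMField.complexConj L) 2 ((StdForm.antidiagonal 2).over L) x) : ℝ) : ℂ)) y)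 g) = (fun y : (quasiSplit (↥(maximalRealSubfield L)) L (IsCMField.complexConj L) 2).Adelic => orbitalSmoothing νG (fun x : (quasiSplit (↥(maximalRealSubfield L)) L (IsCMField.complexConj L) 2).Adelic => ((η i (adelicVal (↥(maximalRealSubfield L)) L (IsCMField.complexConj L) 2 ((StdForm.antidiagonal 2).over L) x) : ℝ) : ℂ)) (fun x : (quasiSplit (↥(maximalRealSubfield L)) L (IsCMField.complexConj L) 2).Adelic => ((η i (adelicVal (↥(maximalRealSubfield L)) L (IsCMField.complexConj L) 2 ((StdForm.antidiagonal 2).over L) x) : ℝ) : ℂ)) y) g) ∧ (∀ g, 0 ≤ ((fun y : (quasiSplit (↥(maximalRealSubfield L)) L (IsCMField.complexConj L) 2).Adelic => orbitalSmoothing νG (fun x : (quasiSplit (↥(maximalRealSubfield L)) L (IsCMField.complexConj L) 2).Adelic => ((η i (adelicVal (↥(maximalRealSubfield L)) L (IsCMField.complexConj L) 2 ((StdForm.antidiagonal 2).over L) x) : ℝ) : ℂ)) (fun x : (quasiSplit (↥(maximalRealSubfield L)) L (IsCMField.complexConj L) 2).Adelic => ((η i (adelicVal (↥(maximalRealSubfield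 L)) L (IsCMField.complexConj L) 2 ((StdForm.antidiagonal 2).over L) x) : ℝ) : ℂ)) y) g).re)) ∧
      -- the EIGENVALUE FUNCTIONS `ŝ_i` (entire), the scalar action of `h_i` on `V ⊗ H^z`, the cover of the ball, and the non-constant member `i₀`
      (∀ i, Differentiable ℂ (ŝ i)) ∧
      (∀ i, ∀ z : ℂ, ∀ φ ∈ chiSectionSpace χ K' ω, ∀ x : (quasiSplit (↥(maximalRealSubfield L)) L (IsCMField.complexConj L) 2).Adelic, (∫ y, (fun y : (quasiSplit (↥(maximalRealSubfield L)) L (IsCMField.complexConj L) 2).Adelic => orbitalSmoothing νG (fun x : (quasiSplit (↥(maximalRealSubfield L)) L (IsCMField.complexConj L) 2).Adelic => ((η i (adelicVal (↥(maximalRealSubfield L)) L (IsCMField.complexConj L) 2 ((StdForm.antidiagonal 2).over L) x) : ℝ) : ℂ)) (fun x : (quasiSplit (↥(maximalRealSubfield L)) L (IsCMField.complexConj L) 2).Adelic => ((η i (adelicVal (↥(maximalRealSubfield L)) L (IsCMField.complexConj L) 2 ((StdForm.antidiagonal 2).over L) x) : ℝ) : ℂ)) y) y * flatSectionU φ z (x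 * y) ∂νG) = ŝ i z * flatSectionU φ z x) ∧
      (∀ z ∈ Metric.ball (0 : ℂ) (n + 2), ∃ i, ŝ i z ≠ 0) ∧
      (∃ z₁ z₂ : ℂ, ŝ i₀ z₁ ≠ ŝ i₀ z₂) ∧ (∃ z ∈ Metric.ball (0 : ℂ) (n + 2), ŝ i₀ z ≠ 0) ∧
      (∀ i, 1 ≤ κ i ∧ a ≤ κ i * a) ∧
      (∀ i, ∀ z : borelQuotient (↥(maximalRealSubfield L)) L (IsCMField.complexConj L) 2, ∀ y ∈ tsupport (fun y : (quasiSplit (↥(maximalRealSubfield L)) L (IsCMField.complexConj L) 2).Adelic => orbitalSmoothing νG (fun x : (quasiSplit (↥(maximalRealSubfield L)) L (IsCMField.complexConj L) 2).Adelic => ((η i (adelicVal (↥(maximalRealSubfield L)) L (IsCMField.complexConj L) 2 ((StdForm.antidiagonal 2).over L) x) : ℝ) : ℂ)) (fun x : (quasiSplit (↥(maximalRealSubfield L)) L (IsCMField.complexConj L) 2).Adelic => ((η i (adelicVal (↥(maximalRealSubfield L)) L (IsCMField.complexConj L) 2 ((StdForm.antidiagonal 2).over L) x) : ℝ) : ℂ))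 y), borelQuotHeight (↥(maximalRealSubfield L)) L (IsCMField.complexConj L) 2 z ≤ κ i * borelQuotHeight (↥(maximalRealSubfield L)) L (IsCMField.complexConj L) 2 (rightShift (↥(maximalRealSubfield L)) L (IsCMField.complexConj L) 2 y z)) ∧
      (∀ i, ∃ hpos : 0 < κ i * a, Function.Injective (iota (iotaBound_cm L μ νG hβ hμZ hpos (n + 3))) ∧
        IsClosed ((LinearMap.range (iota (iotaBound_cm L μ νG hβ hμZ hpos (n + 3))).toLinearMap :
          Submodule ℂ (HN (↥(maximalRealSubfield L)) L (IsCMField.complexConj L) 2 (n + 3) (κ i * a) μZ)) : Set (HN (↥(maximalRealSubfield L)) L (IsCMField.complexConj L) 2 (n + 3) (κ i * a) μZ))) ∧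
      μZ {z | a < borelQuotHeight (↥(maximalRealSubfield L)) L (IsCMField.complexConj L) 2 z} ≠ 0 ∧
      (∀ i, ∀ u : HX (↥(maximalRealSubfield L)) L (IsCMField.complexConj L) 2 (n + 3) μ,
        (T i u : (quasiSplit (↥(maximalRealSubfield L)) L (IsCMField.complexConj L) 2).automorphicQuotient → ℂ) =ᵐ[μ.withDensity fun x =>
            (((supHeight (↥(maximalRealSubfield L)) L (IsCMField.complexConj L) 2 x)⁻¹ ^ (2 * (n + 3)) : ℝ≥0) : ℝ≥0∞)]
          fun ξ => ∫ y, (fun y : (quasiSplit (↥(maximalRealSubfield L)) L (IsCMField.complexConj L) 2).Adelic => orbitalSmoothing νG (fun x : (quasiSplit (↥(maximalRealSubfield L)) L (IsCMField.complexConj L) 2).Adelic => ((η i (adelicVal (↥(maximalRealSubfield L)) L (IsCMField.complexConj L) 2 ((StdForm.antidiagonal 2).over L) x) : ℝ) : ℂ)) (fun x : (quasiSplit (↥(maximalRealSubfield L)) L (IsCMField.complexConj L) 2).Adelic => ((η i (adelicVal (↥(maximalRealSubfield L)) L (IsCMField.complexConj L) 2 ((StdForm.antidiagonal 2).over L) x)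 : ℝ) : ℂ)) y) y * (u : (quasiSplit (↥(maximalRealSubfield L)) L (IsCMField.complexConj L) 2).automorphicQuotient → ℂ) (y⁻¹ • ξ) ∂νG) ∧
      (∀ i, ∃ hs : ShiftBound (↥(maximalRealSubfield L)) L (IsCMField.complexConj L) 2 (n + 3) a (κ i * a) νG μZ (fun y : (quasiSplit (↥(maximalRealSubfield L)) L (IsCMField.complexConj L) 2).Adelic => orbitalSmoothing νG (fun x : (quasiSplit (↥(maximalRealSubfield L)) L (IsCMField.complexConj L) 2).Adelic => ((η i (adelicVal (↥(maximalRealSubfield L)) L (IsCMField.complexConj L) 2 ((StdForm.antidiagonal 2).over L) x) : ℝ) : ℂ)) (fun x : (quasiSplit (↥(maximalRealSubfield L)) L (IsCMField.complexConj L) 2).Adelic => ((η i (adelicVal (↥(maximalRealSubfield L)) L (IsCMField.complexConj L) 2 ((StdForm.antidiagonal 2).over L) x) : ℝ) : ℂ)) y),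
        ∀ (h01 : a ≤ κ i * a),
          deltaShift hs ∘L iota (iotaBound_cm L μ νG hβ hμZ ha (n + 3)) =
            restrHN (↥(maximalRealSubfield L)) L (IsCMField.complexConj L) 2 (n + 3) h01 μZ ∘L iota (iotaBound_cm L μ νG hβ hμZ ha (n + 3)) ∘L T i) :=
  exists_chi_convData_cm_two L μ νG hβ hμZ (chiSectionSpace χ K' ω) (hfam_gauge_cm_two L νG μa μf hK' hKinf U₀ hU₀o hU₀c hU hVc)
    (hnc_gauge_cm_two L νG μa μf hK' hKinf U₀ hU₀o hU₀c hU hVc) n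

/-! ## ED. 2 (K2E1-p16 (g0) 14:41:55Z «hsym at level»): the same ball data WITH the functional-equation symmetry of its eigenvalues, for SELF-DUAL `χ` -/

/-- **THE (χ,τ) BALL DATA AT A GENERAL LEVEL, WITH `ŝ_i(1 − z) = ŝ_i(z)`** (self-dual `χ`): the conclusion of `exists_chi_convData_level_cm_two` AND the conjunct `∀ i z, ŝ i (1 − z) = ŝ i z`, exported
from inside the ∃-package (a consumer cannot add it after `obtain`).  Extra binders = ★ K2E2-p12 `chi_symbol_hsymm_of_selfDual_cm_two`'s: `hsd : χʷ = χ`, a Haar measure `ν` on `N(𝔸)` with a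
compact-closure fundamental domain, ONE measurable bounded section `φ₀ ∈ V(χ, K′, ω)` with a non-vanishing intertwining integral at a Godement point (`hMne`).  Proof: the axis identity
`ŝ_i(½ − it) = ŝ_i(½ + it)` from ★ (its `hR` is the action clause of the package), then the identity principle for the entire `ŝ_i` and `ŝ_i ∘ (1 − ·)` along the critical line
(★ `frequently_line_nhdsWithin`, `AnalyticOnNhd.eqOn_of_preconnected_of_frequently_eq`). [cite: BernsteinLapid2019, §4 Claim 1] [cite: MoeglinWaldspurger1995, IV.1.10] -/
theorem exists_chi_convData_level_cm_two_symm
    (μ : Measure (quasiSplit (↥(maximalRealSubfield L)) L (IsCMField.complexConj L) 2).automorphicQuotient)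
    [(quasiSplit (↥(maximalRealSubfield L)) L (IsCMField.complexConj L) 2).IsAutomorphicMeasure μ]
    (νG : Measure (quasiSplit (↥(maximalRealSubfield L)) L (IsCMField.complexConj L) 2).Adelic) [νG.IsHaarMeasure] [νG.IsInvInvariant] [SFinite νG]
    {β : (quasiSplit (↥(maximalRealSubfield L)) L (IsCMField.complexConj L) 2).Adelic → ℝ≥0∞}
    (hβ : IsCoveringWeight ↥((arithmeticBorel (↥(maximalRealSubfield L)) L (IsCMField.complexConj L) 2).map
      (quasiSplit (↥(maximalRealSubfield L)) L (IsCMField.complexConj L) 2).arithmeticSubgroup.subtype) β)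
    {μZ : Measure (borelQuotient (↥(maximalRealSubfield L)) L (IsCMField.complexConj L) 2)} [SFinite μZ]
    (hμZ : ∀ f : borelQuotient (↥(maximalRealSubfield L)) L (IsCMField.complexConj L) 2 → ℝ≥0∞, Measurable f →
      ∫⁻ z, f z ∂μZ = ∫⁻ g, β g * f (toBorelQuotient (↥(maximalRealSubfield L)) L (IsCMField.complexConj L) 2 g) ∂νG)
    -- auxiliary Haar measures on `G_∞` (two-sided) and `G(𝔸_f)` (they only enter the proof of the letters)
    (μa : Measure (arch (↥(maximalRealSubfield L)) L (IsCMField.complexConj L) 2 ((StdForm.antidiagonal 2).over L))) [μa.IsHaarMeasure] [μa.IsMulRightInvariant]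
    (μf : Measure (finAdelic (↥(maximalRealSubfield L)) L (IsCMField.complexConj L) 2 ((StdForm.antidiagonal 2).over L))) [μf.IsHaarMeasure]
    -- the section space `V(χ, K′, ω)` and its structural binders
    {χ : HeckeCharacter L} {K' : Subgroup (quasiSplit (↥(maximalRealSubfield L)) L (IsCMField.complexConj L) 2).Adelic} {ω : ↥K' → ℂ}
    (hK' : K' ≤ ((standardMaximalCompactGL 2 L).comap (adelicVal (↥(maximalRealSubfield L)) L (IsCMField.complexConj L) 2 ((StdForm.antidiagonal 2).over L)) : Subgroup (quasiSplit (↥(maximalRealSubfield L)) L (IsCMField.complexConj L) 2).Adelic))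
    (hKinf : ∀ k : arch (↥(maximalRealSubfield L)) L (IsCMField.complexConj L) 2 ((StdForm.antidiagonal 2).over L), adelicVal (↥(maximalRealSubfield L)) L (IsCMField.complexConj L) 2 ((StdForm.antidiagonal 2).over L) (archToAdelic (↥(maximalRealSubfield L)) L (IsCMField.complexConj L) 2 _ k) ∈ standardMaximalCompactGL 2 L →
      archToAdelic (↥(maximalRealSubfield L)) L (IsCMField.complexConj L) 2 _ k ∈ K')
    (U₀ : Subgroup (GL (Fin 2) (FiniteAdeleRing (𝓞 L) L))) (hU₀o : IsOpen (U₀ : Set (GL (Fin 2) (FiniteAdeleRing (𝓞 L) L)))) (hU₀c : IsCompact (U₀ : Set (GL (Fin 2) (FiniteAdeleRing (𝓞 L) L))))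
    (hU : ∀ b : finAdelic (↥(maximalRealSubfield L)) L (IsCMField.complexConj L) 2 ((StdForm.antidiagonal 2).over L), (b : GL (Fin 2) (FiniteAdeleRing (𝓞 L) L)) ∈ U₀ →
      ∃ hb : finAdelicToAdelic (↥(maximalRealSubfield L)) L (IsCMField.complexConj L) 2 ((StdForm.antidiagonal 2).over L) b ∈ K', ω ⟨_, hb⟩ = 1)
    (hVc : ∀ φ ∈ chiSectionSpace χ K' ω, Continuous φ)
    -- self-duality data (★ `chi_symbol_hsymm_of_selfDual_cm_two`'s binders)
    (ν : Measure ↥(adelicUnipotent (↥(maximalRealSubfield L)) L (IsCMField.complexConj L) 2)) [ν.IsHaarMeasure] [ν.IsInvInvariant]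
    {𝓕 : Set ↥(adelicUnipotent (↥(maximalRealSubfield L)) L (IsCMField.complexConj L) 2)}
    (h𝓕N : IsFundamentalDomain ↥(rationalUnipotent (↥(maximalRealSubfield L)) L (IsCMField.complexConj L) 2) 𝓕 ν) (h𝓕c : IsCompact (closure 𝓕))
    (hsd : reflectChar (IsCMField.complexConj L) χ = χ)
    {φ₀ : (quasiSplit (↥(maximalRealSubfield L)) L (IsCMField.complexConj L) 2).Adelic → ℂ} (hφ₀ : φ₀ ∈ chiSectionSpace χ K' ω) (hφ₀m : Measurable φ₀) {Cφ : ℝ} (hφ₀C : ∀ x, ‖φ₀ x‖ ≤ Cφ)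
    (hMne : ∃ (g : (quasiSplit (↥(maximalRealSubfield L)) L (IsCMField.complexConj L) 2).Adelic) (w₁ : ℂ), 1 < w₁.re ∧
      ∫ v : ↥(adelicUnipotent (↥(maximalRealSubfield L)) L (IsCMField.complexConj L) 2), flatSectionU φ₀ w₁
        ((quasiSplit (↥(maximalRealSubfield L)) L (IsCMField.complexConj L) 2).toAdelic
          (weylLongU ((IsCMField.complexConj L : L ≃ₐ[↥(maximalRealSubfield L)] L) : L →+* L) (rfl : (StdForm.antidiagonal 2).over L = (StdForm.antidiagonal 2).over L)) *
          ((v : (quasiSplit (↥(maximalRealSubfield L)) L (IsCMField.complexConj L) 2).Adelic) * g)) ∂ν ≠ 0)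
    (n : ℕ) :
    ∃ (a : ℝ≥0) (ha : 0 < a) (I : Type) (_ : Fintype I) (i₀ : I) (η : I → GL (Fin 2) (AdeleRing (𝓞 L) L) → ℝ) (κ : I → ℝ≥0)
      (T : I → HX (↥(maximalRealSubfield L)) L (IsCMField.complexConj L) 2 (n + 3) μ →L[ℂ] HX (↥(maximalRealSubfield L)) L (IsCMField.complexConj L) 2 (n + 3) μ) (ŝ : I → ℂ → ℂ),
      (∀ i (z : ℂ), ŝ i (1 - z) = ŝ i z) ∧
      -- the test functions `η_i` (smooth, non-negative, symmetric) and the self-convolutions `h_i = S_{η_i} η_i` (continuous, compactly supported, symmetric, real, `Re ≥ 0`)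
      (∀ i, IsTestFunctionGL 2 L (η i) ∧ (∀ g, 0 ≤ η i g) ∧ (∀ g, η i g⁻¹ = η i g)) ∧
      (∀ i, Continuous (fun y : (quasiSplit (↥(maximalRealSubfield L)) L (IsCMField.complexConj L) 2).Adelic => orbitalSmoothing νG (fun x : (quasiSplit (↥(maximalRealSubfield L)) L (IsCMField.complexConj L) 2).Adelic => ((η i (adelicVal (↥(maximalRealSubfield L)) L (IsCMField.complexConj L) 2 ((StdForm.antidiagonal 2).over L) x) : ℝ) : ℂ)) (fun x : (quasiSplit (↥(maximalRealSubfield L)) L (IsCMField.complexConj L) 2).Adelic => ((η i (adelicVal (↥(maximalRealSubfield L)) L (IsCMField.complexConj L) 2 ((StdForm.antidiagonal 2).over L) x) : ℝ) : ℂ)) y) ∧ HasCompactSupport (fun y : (quasiSplit (↥(maximalRealSubfield L)) L (IsCMField.complexConj L) 2).Adelic => orbitalSmoothing νG (fun x : (quasiSplit (↥(maximalRealSubfield L)) L (IsCMField.complexConj L) 2).Adelic => ((η i (adelicVal (↥(maximalRealSubfield L)) L (IsCMField.complexConj L) 2 ((StdForm.antidiagonal 2).over L) x) : ℝ) : ℂ))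 (fun x : (quasiSplit (↥(maximalRealSubfield L)) L (IsCMField.complexConj L) 2).Adelic => ((η i (adelicVal (↥(maximalRealSubfield L)) L (IsCMField.complexConj L) 2 ((StdForm.antidiagonal 2).over L) x) : ℝ) : ℂ)) y) ∧
        (∀ g, (fun y : (quasiSplit (↥(maximalRealSubfield L)) L (IsCMField.complexConj L) 2).Adelic => orbitalSmoothing νG (fun x : (quasiSplit (↥(maximalRealSubfield L)) L (IsCMField.complexConj L) 2).Adelic => ((η i (adelicVal (↥(maximalRealSubfield L)) L (IsCMField.complexConj L) 2 ((StdForm.antidiagonal 2).over L) x) : ℝ) : ℂ)) (fun x : (quasiSplit (↥(maximalRealSubfield L)) L (IsCMField.complexConj L) 2).Adelic => ((η i (adelicVal (↥(maximalRealSubfield L)) L (IsCMField.complexConj L) 2 ((StdForm.antidiagonal 2).over L) x) : ℝ) : ℂ)) y) g⁻¹ = (fun y : (quasiSplit (↥(maximalRealSubfield L)) L (IsCMField.complexConj L) 2).Adelic => orbitalSmoothing νG (fun x : (quasiSplit (↥(maximalRealSubfield L)) L (IsCMField.complexConj L) 2).Adelic => ((η i (adelicVal (↥(maximalRealSubfield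 L)) L (IsCMField.complexConj L) 2 ((StdForm.antidiagonal 2).over L) x) : ℝ) : ℂ)) (fun x : (quasiSplit (↥(maximalRealSubfield L)) L (IsCMField.complexConj L) 2).Adelic => ((η i (adelicVal (↥(maximalRealSubfield L)) L (IsCMField.complexConj L) 2 ((StdForm.antidiagonal 2).over L) x) : ℝ) : ℂ)) y) g) ∧ (∀ g, conj ((fun y : (quasiSplit (↥(maximalRealSubfield L)) L (IsCMField.complexConj L) 2).Adelic => orbitalSmoothing νG (fun x : (quasiSplit (↥(maximalRealSubfield L)) L (IsCMField.complexConj L) 2).Adelic => ((η i (adelicVal (↥(maximalRealSubfield L)) L (IsCMField.complexConj L) 2 ((StdForm.antidiagonal 2).over L) x) : ℝ) : ℂ)) (fun x : (quasiSplit (↥(maximalRealSubfield L)) L (IsCMField.complexConj L) 2).Adelic => ((η i (adelicVal (↥(maximalRealSubfield L)) L (IsCMField.complexConj L) 2 ((StdForm.antidiagonal 2).over L) x) : ℝ) : ℂ)) y) g) = (fun y : (quasiSplit (↥(maximalRealSubfield L)) L (IsCMField.complexConj L) 2).Adelic => orbitalSmoothing νG (fun x : (quasiSplit (↥(maximalRealSubfield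 L)) L (IsCMField.complexConj L) 2).Adelic => ((η i (adelicVal (↥(maximalRealSubfield L)) L (IsCMField.complexConj L) 2 ((StdForm.antidiagonal 2).over L) x) : ℝ) : ℂ)) (fun x : (quasiSplit (↥(maximalRealSubfield L)) L (IsCMField.complexConj L) 2).Adelic => ((η i (adelicVal (↥(maximalRealSubfield L)) L (IsCMField.complexConj L) 2 ((StdForm.antidiagonal 2).over L) x) : ℝ) : ℂ)) y) g) ∧ (∀ g, 0 ≤ ((fun y : (quasiSplit (↥(maximalRealSubfield L)) L (IsCMField.complexConj L) 2).Adelic => orbitalSmoothing νG (fun x : (quasiSplit (↥(maximalRealSubfield L)) L (IsCMField.complexConj L) 2).Adelic => ((η i (adelicVal (↥(maximalRealSubfield L)) L (IsCMField.complexConj L) 2 ((StdForm.antidiagonal 2).over L) x) : ℝ) : ℂ)) (fun x : (quasiSplit (↥(maximalRealSubfield L)) L (IsCMField.complexConj L) 2).Adelic => ((η i (adelicVal (↥(maximalRealSubfield L)) L (IsCMField.complexConj L) 2 ((StdForm.antidiagonal 2).over L) x) : ℝ) : ℂ)) y) g).re)) ∧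
      -- the EIGENVALUE FUNCTIONS `ŝ_i` (entire), the scalar action of `h_i` on `V ⊗ H^z`, the cover of the ball, and the non-constant member `i₀`
      (∀ i, Differentiable ℂ (ŝ i)) ∧
      (∀ i, ∀ z : ℂ, ∀ φ ∈ chiSectionSpace χ K' ω, ∀ x : (quasiSplit (↥(maximalRealSubfield L)) L (IsCMField.complexConj L) 2).Adelic, (∫ y, (fun y : (quasiSplit (↥(maximalRealSubfield L)) L (IsCMField.complexConj L) 2).Adelic => orbitalSmoothing νG (fun x : (quasiSplit (↥(maximalRealSubfield L)) L (IsCMField.complexConj L) 2).Adelic => ((η i (adelicVal (↥(maximalRealSubfield L)) L (IsCMField.complexConj L) 2 ((StdForm.antidiagonal 2).over L) x) : ℝ) : ℂ)) (fun x : (quasiSplit (↥(maximalRealSubfield L)) L (IsCMField.complexConj L) 2).Adelic => ((η i (adelicVal (↥(maximalRealSubfield L)) L (IsCMField.complexConj L) 2 ((StdForm.antidiagonal 2).over L) x) : ℝ) : ℂ)) y) y * flatSectionU φ z (x * y) ∂νG) = ŝ i z * flatSectionU φ z x) ∧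
      (∀ z ∈ Metric.ball (0 : ℂ) (n + 2), ∃ i, ŝ i z ≠ 0) ∧
      (∃ z₁ z₂ : ℂ, ŝ i₀ z₁ ≠ ŝ i₀ z₂) ∧ (∃ z ∈ Metric.ball (0 : ℂ) (n + 2), ŝ i₀ z ≠ 0) ∧
      (∀ i, 1 ≤ κ i ∧ a ≤ κ i * a) ∧
      (∀ i, ∀ z : borelQuotient (↥(maximalRealSubfield L)) L (IsCMField.complexConj L) 2, ∀ y ∈ tsupport (fun y : (quasiSplit (↥(maximalRealSubfield L)) L (IsCMField.complexConj L) 2).Adelic => orbitalSmoothing νG (fun x : (quasiSplit (↥(maximalRealSubfield L)) L (IsCMField.complexConj L) 2).Adelic => ((η i (adelicVal (↥(maximalRealSubfield L)) L (IsCMField.complexConj L) 2 ((StdForm.antidiagonal 2).over L) x) : ℝ) : ℂ)) (fun x : (quasiSplit (↥(maximalRealSubfield L)) L (IsCMField.complexConj L) 2).Adelic => ((η i (adelicVal (↥(maximalRealSubfield L)) L (IsCMField.complexConj L) 2 ((StdForm.antidiagonal 2).over L) x) : ℝ) : ℂ)) y), borelQuotHeight (↥(maximalRealSubfield L)) L (IsCMField.complexConj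 L) 2 z ≤ κ i * borelQuotHeight (↥(maximalRealSubfield L)) L (IsCMField.complexConj L) 2 (rightShift (↥(maximalRealSubfield L)) L (IsCMField.complexConj L) 2 y z)) ∧
      (∀ i, ∃ hpos : 0 < κ i * a, Function.Injective (iota (iotaBound_cm L μ νG hβ hμZ hpos (n + 3))) ∧
        IsClosed ((LinearMap.range (iota (iotaBound_cm L μ νG hβ hμZ hpos (n + 3))).toLinearMap :
          Submodule ℂ (HN (↥(maximalRealSubfield L)) L (IsCMField.complexConj L) 2 (n + 3) (κ i * a) μZ)) : Set (HN (↥(maximalRealSubfield L)) L (IsCMField.complexConj L) 2 (n + 3) (κ i * a) μZ))) ∧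
      μZ {z | a < borelQuotHeight (↥(maximalRealSubfield L)) L (IsCMField.complexConj L) 2 z} ≠ 0 ∧
      (∀ i, ∀ u : HX (↥(maximalRealSubfield L)) L (IsCMField.complexConj L) 2 (n + 3) μ,
        (T i u : (quasiSplit (↥(maximalRealSubfield L)) L (IsCMField.complexConj L) 2).automorphicQuotient → ℂ) =ᵐ[μ.withDensity fun x =>
            (((supHeight (↥(maximalRealSubfield L)) L (IsCMField.complexConj L) 2 x)⁻¹ ^ (2 * (n + 3)) : ℝ≥0) : ℝ≥0∞)]
          fun ξ => ∫ y, (fun y : (quasiSplit (↥(maximalRealSubfield L)) L (IsCMField.complexConj L) 2).Adelic => orbitalSmoothing νG (fun x : (quasiSplit (↥(maximalRealSubfield L)) L (IsCMField.complexConj L) 2).Adelic => ((η i (adelicVal (↥(maximalRealSubfield L)) L (IsCMField.complexConj L) 2 ((StdForm.antidiagonal 2).over L) x) : ℝ) : ℂ)) (fun x : (quasiSplit (↥(maximalRealSubfield L)) L (IsCMField.complexConj L) 2).Adelic => ((η i (adelicVal (↥(maximalRealSubfield L)) L (IsCMField.complexConj L) 2 ((StdForm.antidiagonal 2).over L) x)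 : ℝ) : ℂ)) y) y * (u : (quasiSplit (↥(maximalRealSubfield L)) L (IsCMField.complexConj L) 2).automorphicQuotient → ℂ) (y⁻¹ • ξ) ∂νG) ∧
      (∀ i, ∃ hs : ShiftBound (↥(maximalRealSubfield L)) L (IsCMField.complexConj L) 2 (n + 3) a (κ i * a) νG μZ (fun y : (quasiSplit (↥(maximalRealSubfield L)) L (IsCMField.complexConj L) 2).Adelic => orbitalSmoothing νG (fun x : (quasiSplit (↥(maximalRealSubfield L)) L (IsCMField.complexConj L) 2).Adelic => ((η i (adelicVal (↥(maximalRealSubfield L)) L (IsCMField.complexConj L) 2 ((StdForm.antidiagonal 2).over L) x) : ℝ) : ℂ)) (fun x : (quasiSplit (↥(maximalRealSubfield L)) L (IsCMField.complexConj L) 2).Adelic => ((η i (adelicVal (↥(maximalRealSubfield L)) L (IsCMField.complexConj L) 2 ((StdForm.antidiagonal 2).over L) x) : ℝ) : ℂ)) y),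
        ∀ (h01 : a ≤ κ i * a),
          deltaShift hs ∘L iota (iotaBound_cm L μ νG hβ hμZ ha (n + 3)) =
            restrHN (↥(maximalRealSubfield L)) L (IsCMField.complexConj L) 2 (n + 3) h01 μZ ∘L iota (iotaBound_cm L μ νG hβ hμZ ha (n + 3)) ∘L T i)  := by
  obtain ⟨a, ha, I, hI, i₀, η, κ, T, ŝ, hη, hconv, hŝd, hact, hcov, hnc, hne0, hκ, hcmp, hι, hμZne, hT, hpack⟩ :=
    exists_chi_convData_level_cm_two L μ νG hβ hμZ μa μf hK' hKinf U₀ hU₀o hU₀c hU hVc n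
  refine ⟨a, ha, I, hI, i₀, η, κ, T, ŝ, fun i => ?_, hη, hconv, hŝd, hact, hcov, hnc, hne0, hκ, hcmp, hι, hμZne, hT, hpack⟩
  -- the axis identity from ★ K2E2-p12 (self-dual χ)
  have haxis : ∀ t : ℝ, ŝ i (1 / 2 - t * Complex.I) = ŝ i (1 / 2 + t * Complex.I) := fun t =>
    chi_symbol_hsymm_of_selfDual_cm_two L νG ν h𝓕N h𝓕c hsd hK' hφ₀ hφ₀m hφ₀C (hconv i).1 (hconv i).2.1 (ŝ i) (hŝd i) (fun z ψ hψ x => hact i z ψ hψ x) hMne t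
  -- identity principle: `z ↦ ŝ i (1 - z)` and `ŝ i` are entire and agree along the critical line near `½`
  have h1 : AnalyticOnNhd ℂ (fun z => ŝ i (1 - z)) univ :=
    Complex.analyticOnNhd_univ_iff_differentiable.2 ((hŝd i).comp (differentiable_const _ |>.sub differentiable_id))
  have h2 : AnalyticOnNhd ℂ (ŝ i) univ := Complex.analyticOnNhd_univ_iff_differentiable.2 (hŝd i)
  have hfreq : ∃ᶠ z in 𝓝[≠] ((1 / 2 : ℂ)), (fun z => ŝ i (1 - z)) z = ŝ i z := by
    refine frequently_line_nhdsWithin (1 / 2 : ℂ) Complex.I Complex.I_ne_zero (p := fun z => (fun z => ŝ i (1 - z)) z = ŝ i z) fun t _ => ?_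
    show ŝ i (1 - (1 / 2 + (t : ℂ) * Complex.I)) = ŝ i (1 / 2 + (t : ℂ) * Complex.I)
    rw [show (1 : ℂ) - (1 / 2 + (t : ℂ) * Complex.I) = 1 / 2 - (t : ℂ) * Complex.I by ring]
    exact haxis t
  have heq := h1.eqOn_of_preconnected_of_frequently_eq h2 isPreconnected_univ (mem_univ _) hfreq
  exact fun z => heq (mem_univ z)

end Summit.HodgeConjecture.HodgeConjecture.Cruxes.H413.K2E1ChiConvDataLevelCMTwo
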